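import Literature.Probability.RandomPlanarGeometry.BrownianBubbles
import Literature.Probability.RandomPlanarGeometry.RestrictionHullsRiemannProofs
import Literature.Probability.RandomPlanarGeometry.HydrodynamicMaps
import Literature.Probability.RandomPlanarGeometry.CaratheodoryHalfPlane
import HarnessLib

/-!
# [LSW] (5.1): `−SΦ_A(0)/6 = a({−1/z : z ∈ A})` — the bubble hitting mass of a hull is the half-plane capacity of the inverted hull, hence `≥ 0`

Proof-only companion (auxiliary definitions: a set, two conformal maps, three rational expressions;
no named fact) of `BrownianBubbles` / `SLEBubblesSchwarzianMass`, after

* G. F. Lawler, O. Schramm, W. Werner, *Conformal restriction: the chordal case*, J. Amer. Math.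
  Soc. **16** (2003) 917–955, arXiv:math/0209343 (**[LSW]**), §5, eq. (5.1) and the lines
  around it: "An easy direct calculation shows that `Sf(0) = −6 a(A)` when `f(z) = g_A(−1/z)`.
  Since `S(m ∘ f) = S(f)` for Möbius transformations `m`, it follows that
  (5.1) `S g_A(0) = −6 a({−z⁻¹ : z ∈ A})`. Consequently, `Sg_A ≤ 0` on `ℝ ∖ A`. (In fact, in §7 we
  show that `−Sg_A(z)/6` is a hitting measure for Brownian bubbles.)"; Prop. 5.3: "The bound on
  `Y_t` follows from `Sh_t(W_t) ≤ 0`"; §7.1 (7.2) `μ[K ∩ A ≠ ∅] = −Sg_A(0)/6` with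
  `ν[K ∩ A ≠ ∅] = a(A)` for the bubbles at infinity;
* G. F. Lawler, *Conformally Invariant Processes in the Plane*, AMS (2005), §3.4 (the half-plane
  capacity `hcap`, Def. 3.37, `hcap ≥ 0`, additivity (3.8)/(3.10)) and Prop. 5.22
  (`μ^bub(0){γ ⊄ D} = hcap(A) = −Sf(0)/6`, `f(z) = z + x z² + [x² − hcap(A)] z³ + ⋯`).

With the tree's conventions (`HasRestrictionJet A Φ d c₂ c₃`: `Φ(z) = d z + c₂ z² + c₃ z³ + o(z³)`
in `ℍ ∖ A`; `bubbleMass d c₂ c₃ = c₂²/d² − c₃/d = −SΦ(0)/6`; `hcap K φ` and `IsHydrodynamicMap` of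
`HydrodynamicMaps`, the function-theoretic half-plane capacity `lim z (φ(z) − z)`), we PROVE:

* `Literature.Probability.RandomPlanarGeometry.invHull A = {w : −1/w ∈ A} = {−1/z : z ∈ A}` — the
  inverted hull; for `A` off a ball `B(0, δ)` it is bounded (`invHull_subset_closedBall`);
* `Literature.Probability.RandomPlanarGeometry.invertedMap Φ d hd b` — the conformal map
  `ψ(w) = −d/Φ(−1/w) − b` of `ℍ ∖ invHull A` onto `ℍ` (inversion, `Φ`, inversion, the dilation
  by `d > 0` and a real translation, all automorphisms of `ℍ`), with `invertedMap_apply`;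
* `Literature.Probability.RandomPlanarGeometry.HasRestrictionJet.isHydrodynamicMap_invertedMap` —
  for `b = c₂/d` this map is hydrodynamically normalized, `ψ(w) − w → 0` at `∞`, and
  **`HasRestrictionJet.hcap_invertedMap`: `hcap(invHull A, ψ) = c₂²/d² − c₃/d = bubbleMass d c₂ c₃`**
  — this is (5.1): the expansion `Φ(z) = d z + c₂ z² + c₃ z³ + z³ R(z)`, `R → 0`, gives the
  identity `ψ(w) − w = z [(d c₃ − c₂²) + d R − c₂ c₃ z − c₂ z R] / (d (d + c₂ z + c₃ z² + z² R))`,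
  `z = −1/w` (`invertedMap_sub_self_eq`), whence `w (ψ(w) − w) → (c₂² − d c₃)/d²`;
* consequences: **`HasRestrictionJet.bubbleMass_nonneg`** (`−SΦ_A(0)/6 ≥ 0`, [LSW] "`Sg_A ≤ 0`",
  from `hcap ≥ 0`) and `HasRestrictionJet.bubbleMass_pos` (`> 0` as soon as `A` meets `ℍ`, from
  `hcap > 0`). The corollaries for `*`-hulls and the canonical jets of `SLEBubblesSchwarzianMass`
  (`starBubbleMass ≥ 0`, `> 0`, monotone in the hull; hitting masses of Brownian bubble measures
  as real numbers) are in the sibling file `StarBubbleMassSign`.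

These are the sign inputs of [LSW] Prop. 5.3 / Thm. 6.5 (`0 ≤ Y_t ≤ 1`) for the Schwarzian
functional of `SLEBubbles.lintegral_poissonAvoidance_eq_rpow_of_thm65`; and (5.1) is the bridge
between (7.2) and the capacity form `ν[K ∩ A ≠ ∅] = a(A)` of the Brownian bubble measure at
infinity ([LSW] §7.1).

## References

* [LSW] §5 eq. (5.1); Prop. 5.3; §7.1 (7.1)–(7.2). [LawlerSchrammWerner2003Restriction]
* Lawler (2005), §3.4 Def. 3.37, (3.8)–(3.10); §5.5 Prop. 5.22. [Lawler2005]
-/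

noncomputable section

open Set Filter Topology Metric Complex Bornology
open UpperHalfPlane (upperHalfPlaneSet isOpen_upperHalfPlaneSet)
open scoped NNReal ENNReal

namespace Literature.Probability.RandomPlanarGeometry

/-! ### The inverted hull `{w : −1/w ∈ A}` -/

/-- **The inverted hull** `{w : −1/w ∈ A}` of `A ⊆ ℂ`, i.e. `{−1/z : z ∈ A}` ([LSW] (5.1):
"`{−z⁻¹ : z ∈ A}`"), the inversion `z ↦ −1/z` being an involution of `ℂ` (junk `0⁻¹ = 0`)
preserving `ℍ`. [cite: LawlerSchrammWerner2003Restriction, §5 eq. (5.1)] -/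
def invHull (A : Set ℂ) : Set ℂ := (fun z : ℂ ↦ -z⁻¹) ⁻¹' A

/-- Membership in the inverted hull. [folklore] -/
theorem mem_invHull_iff {A : Set ℂ} {w : ℂ} : w ∈ invHull A ↔ -w⁻¹ ∈ A := Iff.rfl

/-- `invHull A = {−1/z : z ∈ A}`. [folklore] -/
theorem invHull_eq_image (A : Set ℂ) : invHull A = (fun z : ℂ ↦ -z⁻¹) '' A := by
  ext w
  constructor
  · intro hw
    exact ⟨-w⁻¹, hw, neg_inv_neg_inv w⟩
  · rintro ⟨z, hz, rfl⟩
    show -(-z⁻¹)⁻¹ ∈ A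
    rwa [neg_inv_neg_inv]

/-- Inversion is an involution on hulls. [folklore] -/
@[simp] theorem invHull_invHull (A : Set ℂ) : invHull (invHull A) = A := by
  ext z
  simp [mem_invHull_iff]

/-- `invHull` is monotone. [folklore] -/
theorem invHull_mono {A B : Set ℂ} (h : A ⊆ B) : invHull A ⊆ invHull B := preimage_mono h

/-- `{w : −1/w ∈ ℍ} = ℍ`. [folklore] -/
theorem preimage_negInv_upperHalfPlaneSet :
    (fun z : ℂ ↦ -z⁻¹) ⁻¹' upperHalfPlaneSet = upperHalfPlaneSet := by
  ext w
  constructor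
  · intro hw
    have := neg_inv_mem_upperHalfPlaneSet hw
    rwa [neg_inv_neg_inv] at this
  · exact fun hw ↦ neg_inv_mem_upperHalfPlaneSet hw

/-- `{w : −1/w ∈ ℍ ∖ A} = ℍ ∖ invHull A`. [folklore] -/
theorem preimage_negInv_diff (A : Set ℂ) :
    (fun z : ℂ ↦ -z⁻¹) ⁻¹' (upperHalfPlaneSet \ A) = upperHalfPlaneSet \ invHull A := by
  rw [preimage_sdiff, preimage_negInv_upperHalfPlaneSet, invHull]

/-- Points of `ℍ ∖ invHull A` invert into `ℍ ∖ A`. [folklore] -/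
theorem neg_inv_mem_diff {A : Set ℂ} {w : ℂ} (hw : w ∈ upperHalfPlaneSet \ invHull A) :
    -w⁻¹ ∈ upperHalfPlaneSet \ A := by
  rw [← preimage_negInv_diff] at hw
  exact hw

/-- **A hull off the ball `B(0, δ)` inverts into the disc `B̄(0, 1/δ)`.** [folklore] -/
theorem invHull_subset_closedBall {A : Set ℂ} {δ : ℝ} (hδ : 0 < δ) (hA : Disjoint (ball (0 : ℂ) δ) A) :
    invHull A ⊆ closedBall (0 : ℂ) δ⁻¹ := by
  intro w hw
  rw [mem_invHull_iff] at hw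
  have hnot : -w⁻¹ ∉ ball (0 : ℂ) δ := fun h ↦ Set.disjoint_left.1 hA h hw
  rw [mem_ball_zero_iff, not_lt, norm_neg, norm_inv] at hnot
  rw [mem_closedBall_zero_iff]
  have hw0 : 0 < ‖w‖ := by
    by_contra h
    push Not at h
    have h0 : ‖w‖ = 0 := le_antisymm h (norm_nonneg _)
    rw [h0, inv_zero] at hnot
    linarith
  calc ‖w‖ = (‖w‖⁻¹)⁻¹ := (inv_inv _).symm
    _ ≤ δ⁻¹ := inv_anti₀ hδ hnot

/-- The part in `ℍ` of the inverted hull of a hull off a ball about `0` is bounded. [folklore] -/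
theorem isBounded_invHull_inter {A : Set ℂ} {δ : ℝ} (hδ : 0 < δ) (hA : Disjoint (ball (0 : ℂ) δ) A) :
    IsBounded (invHull A ∩ upperHalfPlaneSet) :=
  isBounded_closedBall.subset (inter_subset_left.trans (invHull_subset_closedBall hδ hA))

/-- If `A` meets `ℍ`, so does its inverted hull. [folklore] -/
theorem invHull_inter_nonempty {A : Set ℂ} (hne : (A ∩ upperHalfPlaneSet).Nonempty) :
    (invHull A ∩ upperHalfPlaneSet).Nonempty := by
  obtain ⟨z, hzA, hzH⟩ := hne
  refine ⟨-z⁻¹, ?_, neg_inv_mem_upperHalfPlaneSet hzH⟩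
  show -(-z⁻¹)⁻¹ ∈ A
  rwa [neg_inv_neg_inv]

/-! ### The inversion as conformal equivalences -/

/-- `0 ∉ ℍ ∖ A`. [folklore] -/
theorem diff_subset_ne_zero (A : Set ℂ) : upperHalfPlaneSet \ A ⊆ {z : ℂ | z ≠ 0} := by
  rintro z hz rfl
  exact absurd hz.1 (by simp [upperHalfPlaneSet])

/-- **The inversion `z ↦ −1/z` as a conformal equivalence `ℍ ∖ A → ℍ ∖ invHull A`.** [folklore] -/
def invEquiv (A : Set ℂ) : ConformalEquiv (upperHalfPlaneSet \ A) (upperHalfPlaneSet \ invHull A) :=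
  ((exists_conformalEquiv_neg_inv (upperHalfPlaneSet \ A) (diff_subset_ne_zero A)).choose).copy
    _ _ rfl (preimage_negInv_diff A).symm

/-- The inversion equivalence acts as `z ↦ −1/z`. [folklore] -/
@[simp] theorem invEquiv_apply (A : Set ℂ) (z : ℂ) : invEquiv A z = -z⁻¹ := by
  rw [invEquiv, ConformalEquiv.copy_apply]
  exact (exists_conformalEquiv_neg_inv (upperHalfPlaneSet \ A) (diff_subset_ne_zero A)).choose_spec z

/-- Its inverse acts as `w ↦ −1/w` on `ℍ ∖ invHull A`. [folklore] -/
theorem invEquiv_symm_apply {A : Set ℂ} {w : ℂ} (hw : w ∈ upperHalfPlaneSet \ invHull A) :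
    (invEquiv A).symm w = -w⁻¹ := by
  have h := (invEquiv A).symm_apply_apply (neg_inv_mem_diff hw)
  rwa [invEquiv_apply, neg_inv_neg_inv] at h

/-- `0 ∉ ℍ`. [folklore] -/
theorem upperHalfPlaneSet_subset_ne_zero : upperHalfPlaneSet ⊆ {z : ℂ | z ≠ 0} := by
  rintro z hz rfl
  exact absurd hz (by simp [upperHalfPlaneSet])

/-- **The inversion `z ↦ −1/z` as a conformal automorphism of `ℍ`.** [folklore] -/
def invEquivUpperHalfPlane : ConformalEquiv upperHalfPlaneSet upperHalfPlaneSet :=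
  ((exists_conformalEquiv_neg_inv upperHalfPlaneSet upperHalfPlaneSet_subset_ne_zero).choose).copy
    _ _ rfl preimage_negInv_upperHalfPlaneSet.symm

/-- The inversion of `ℍ` acts as `z ↦ −1/z`. [folklore] -/
@[simp] theorem invEquivUpperHalfPlane_apply (z : ℂ) : invEquivUpperHalfPlane z = -z⁻¹ := by
  rw [invEquivUpperHalfPlane, ConformalEquiv.copy_apply]
  exact (exists_conformalEquiv_neg_inv upperHalfPlaneSet upperHalfPlaneSet_subset_ne_zero).choose_spec z

/-- **The inverted map** `ψ(w) = −d/Φ(−1/w) − b` of a conformal map `Φ : ℍ ∖ A → ℍ`: a conformal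
map `ℍ ∖ invHull A → ℍ` ([LSW] §5: "`f(z) = g_A(−1/z)`" followed by a Möbius map of `ℍ`; here the
inversion `−1/·`, the dilation by `d > 0` and the translation by `−b`, chosen below so that `ψ`
is hydrodynamically normalized). [cite: LawlerSchrammWerner2003Restriction, §5 eq. (5.1)] -/
def invertedMap {A : Set ℂ} (Φ : ConformalEquiv (upperHalfPlaneSet \ A) upperHalfPlaneSet)
    (d : ℝ) (hd : 0 < d) (b : ℝ) : ConformalEquiv (upperHalfPlaneSet \ invHull A) upperHalfPlaneSet :=
  (invEquiv A).symm.trans (Φ.trans (invEquivUpperHalfPlane.trans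
    ((ConformalEquiv.smulUpperHalfPlane d hd).trans (addRealUpperHalfPlane (-b)))))

/-- `ψ(w) = d · (−1/Φ(−1/w)) − b` on `ℍ ∖ invHull A`. [folklore] -/
theorem invertedMap_apply {A : Set ℂ} (Φ : ConformalEquiv (upperHalfPlaneSet \ A) upperHalfPlaneSet)
    {d : ℝ} (hd : 0 < d) (b : ℝ) {w : ℂ} (hw : w ∈ upperHalfPlaneSet \ invHull A) :
    invertedMap Φ d hd b w = (d : ℂ) * (-(Φ (-w⁻¹))⁻¹) - b := by
  simp only [invertedMap, ConformalEquiv.trans_apply]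
  rw [invEquiv_symm_apply hw, invEquivUpperHalfPlane_apply, ConformalEquiv.smulUpperHalfPlane_apply,
    addRealUpperHalfPlane_apply, Complex.real_smul]
  push_cast
  ring

/-! ### The expansion at `∞` of the inverted map from the jet of `Φ` at `0` -/

section Expansion

variable {A : Set ℂ} {Φ : ConformalEquiv (upperHalfPlaneSet \ A) upperHalfPlaneSet} {d c₂ c₃ : ℝ}

/-- The jet remainder `R(z) = (Φ(z) − (d z + c₂ z² + c₃ z³))/z³` (`→ 0` at `0` in `ℍ ∖ A` iff
`HasRestrictionJet A Φ d c₂ c₃`). [folklore] -/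
def jetRem (Φ : ConformalEquiv (upperHalfPlaneSet \ A) upperHalfPlaneSet) (d c₂ c₃ : ℝ) (z : ℂ) : ℂ :=
  (Φ z - ((d : ℂ) * z + (c₂ : ℂ) * z ^ 2 + (c₃ : ℂ) * z ^ 3)) / z ^ 3

/-- The numerator `(d c₃ − c₂²) + d R − c₂ c₃ z − c₂ z R` of the expansion of `ψ(w) − w`.
[folklore] -/
def jetNum (Φ : ConformalEquiv (upperHalfPlaneSet \ A) upperHalfPlaneSet) (d c₂ c₃ : ℝ) (z : ℂ) : ℂ :=
  ((d : ℂ) * c₃ - (c₂ : ℂ) ^ 2) + d * jetRem Φ d c₂ c₃ z - c₂ * c₃ * z - c₂ * z * jetRem Φ d c₂ c₃ z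

/-- The denominator `d (d + c₂ z + c₃ z² + z² R) (= d Φ(z)/z)` of the expansion of `ψ(w) − w`.
[folklore] -/
def jetDen (Φ : ConformalEquiv (upperHalfPlaneSet \ A) upperHalfPlaneSet) (d c₂ c₃ : ℝ) (z : ℂ) : ℂ :=
  (d : ℂ) * (d + c₂ * z + c₃ * z ^ 2 + z ^ 2 * jetRem Φ d c₂ c₃ z)

/-- **The algebra of (5.1)**: for nonzero `z`, `Φz`, `d`, with `R = (Φz − (d z + c₂ z² + c₃ z³))/z³`,
`d (−1/Φz) − c₂/d − (−1/z) = z · [(d c₃ − c₂²) + d R − c₂ c₃ z − c₂ z R] / (d (d + c₂ z + c₃ z² + z² R))`.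
[folklore] -/
theorem invertedMap_algebra {z Φz d c₂ c₃ : ℂ} (hz : z ≠ 0) (hΦ : Φz ≠ 0) (hd : d ≠ 0) :
    d * (-Φz⁻¹) - c₂ / d - (-z⁻¹) =
      z * ((d * c₃ - c₂ ^ 2 + d * ((Φz - (d * z + c₂ * z ^ 2 + c₃ * z ^ 3)) / z ^ 3) - c₂ * c₃ * z -
          c₂ * z * ((Φz - (d * z + c₂ * z ^ 2 + c₃ * z ^ 3)) / z ^ 3)) /
        (d * (d + c₂ * z + c₃ * z ^ 2 + z ^ 2 * ((Φz - (d * z + c₂ * z ^ 2 + c₃ * z ^ 3)) / z ^ 3)))) := by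
  have hQ : d + c₂ * z + c₃ * z ^ 2 + z ^ 2 * ((Φz - (d * z + c₂ * z ^ 2 + c₃ * z ^ 3)) / z ^ 3) = Φz / z := by
    field_simp
    ring
  rw [hQ]
  field_simp
  ring

/-- **`−1/w → 0` inside `ℍ ∖ A` as `w → ∞` inside `ℍ ∖ invHull A`.** [folklore] -/
theorem tendsto_neg_inv_cocompact_inf (A : Set ℂ) :
    Tendsto (fun w : ℂ ↦ -w⁻¹) (cocompact ℂ ⊓ 𝓟 (upperHalfPlaneSet \ invHull A))
      (𝓝[upperHalfPlaneSet \ A] 0) := by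
  refine tendsto_nhdsWithin_iff.2 ⟨?_, ?_⟩
  · have h : Tendsto (fun w : ℂ ↦ w⁻¹) (cocompact ℂ) (𝓝 0) := by
      rw [← cobounded_eq_cocompact]
      exact tendsto_inv₀_cobounded
    simpa using h.neg.mono_left inf_le_left
  · filter_upwards [mem_inf_of_right (mem_principal_self _)] with w hw
    exact neg_inv_mem_diff hw

/-- **The inverted map minus the identity, expanded** ([LSW] (5.1), the "easy direct
calculation"): on `ℍ ∖ invHull A`, with `z = −1/w`,
`ψ(w) − w = z · jetNum(z) / jetDen(z)` for `ψ = invertedMap Φ d hd (c₂/d)`.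
[cite: LawlerSchrammWerner2003Restriction, §5 eq. (5.1)] -/
theorem invertedMap_sub_self_eq (hd : 0 < d) {w : ℂ} (hw : w ∈ upperHalfPlaneSet \ invHull A) :
    invertedMap Φ d hd (c₂ / d) w - w =
      (-w⁻¹) * (jetNum Φ d c₂ c₃ (-w⁻¹) / jetDen Φ d c₂ c₃ (-w⁻¹)) := by
  have hz : -w⁻¹ ∈ upperHalfPlaneSet \ A := neg_inv_mem_diff hw
  have hz0 : -w⁻¹ ≠ 0 := diff_subset_ne_zero A hz
  have hΦ0 : (Φ (-w⁻¹) : ℂ) ≠ 0 := by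
    have him : 0 < (Φ (-w⁻¹)).im := Φ.mapsTo hz
    intro h
    rw [h] at him
    simp at him
  have hd0 : (d : ℂ) ≠ 0 := by exact_mod_cast hd.ne'
  rw [invertedMap_apply Φ hd (c₂ / d) hw, Complex.ofReal_div]
  have hw' : w = -(-w⁻¹)⁻¹ := (neg_inv_neg_inv w).symm
  conv_lhs => arg 2; rw [hw']
  simp only [jetNum, jetDen, jetRem]
  exact invertedMap_algebra hz0 hΦ0 hd0

variable (hJ : HasRestrictionJet A Φ d c₂ c₃) (hd : 0 < d)
include hJ hd

omit hd in
/-- The three limits at `∞` in `ℍ ∖ invHull A`: `z → 0`, `jetNum(z) → d c₃ − c₂²`,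
`jetDen(z) → d²` (`z = −1/w`, `R(z) → 0` by the jet hypothesis). [folklore] -/
theorem HasRestrictionJet.tendsto_jetNum_jetDen :
    Tendsto (fun w : ℂ ↦ -w⁻¹) (cocompact ℂ ⊓ 𝓟 (upperHalfPlaneSet \ invHull A)) (𝓝 0) ∧
    Tendsto (fun w : ℂ ↦ jetNum Φ d c₂ c₃ (-w⁻¹)) (cocompact ℂ ⊓ 𝓟 (upperHalfPlaneSet \ invHull A))
      (𝓝 ((d : ℂ) * c₃ - (c₂ : ℂ) ^ 2)) ∧
    Tendsto (fun w : ℂ ↦ jetDen Φ d c₂ c₃ (-w⁻¹)) (cocompact ℂ ⊓ 𝓟 (upperHalfPlaneSet \ invHull A))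
      (𝓝 ((d : ℂ) * d)) := by
  set F := cocompact ℂ ⊓ 𝓟 (upperHalfPlaneSet \ invHull A) with hF
  have hT := tendsto_neg_inv_cocompact_inf A
  have hz : Tendsto (fun w : ℂ ↦ -w⁻¹) F (𝓝 0) := hT.mono_right nhdsWithin_le_nhds
  have hR : Tendsto (fun w : ℂ ↦ jetRem Φ d c₂ c₃ (-w⁻¹)) F (𝓝 0) := hJ.comp hT
  refine ⟨hz, ?_, ?_⟩
  · have h := ((tendsto_const_nhds (x := (d : ℂ) * c₃ - (c₂ : ℂ) ^ 2)).add
      (hR.const_mul (d : ℂ))).sub (hz.const_mul ((c₂ : ℂ) * c₃))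
    have h' := h.sub ((hz.const_mul (c₂ : ℂ)).mul hR)
    simp only [mul_zero, add_zero, sub_zero] at h'
    exact h'
  · have h := ((((tendsto_const_nhds (x := (d : ℂ))).add (hz.const_mul (c₂ : ℂ))).add
      ((hz.pow 2).const_mul (c₃ : ℂ))).add ((hz.pow 2).mul hR)).const_mul (d : ℂ)
    simp only [mul_zero, add_zero, ne_eq, OfNat.ofNat_ne_zero, not_false_eq_true, zero_pow] at h
    exact h

/-- **`ψ(w) − w → 0`**: the inverted map with `b = c₂/d` is hydrodynamically normalized.
[cite: LawlerSchrammWerner2003Restriction, §5 eq. (5.1)] -/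
theorem HasRestrictionJet.isHydrodynamicMap_invertedMap :
    IsHydrodynamicMap (invHull A) (invertedMap Φ d hd (c₂ / d)) := by
  obtain ⟨hz, hN, hD⟩ := hJ.tendsto_jetNum_jetDen
  have hd0 : (d : ℂ) ≠ 0 := by exact_mod_cast hd.ne'
  have hlim := hz.mul (hN.div hD (mul_ne_zero hd0 hd0))
  rw [zero_mul] at hlim
  refine hlim.congr' ?_
  filter_upwards [mem_inf_of_right (mem_principal_self _)] with w hw
  simp only [Pi.div_apply]
  exact (invertedMap_sub_self_eq hd hw).symm

/-- **(5.1), the limit**: `w (ψ(w) − w) → (c₂² − d c₃)/d² = bubbleMass d c₂ c₃` at `∞` in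
`ℍ ∖ invHull A`. [cite: LawlerSchrammWerner2003Restriction, §5 eq. (5.1)] -/
theorem HasRestrictionJet.tendsto_mul_invertedMap_sub_self :
    Tendsto (fun w ↦ w * (invertedMap Φ d hd (c₂ / d) w - w))
      (cocompact ℂ ⊓ 𝓟 (upperHalfPlaneSet \ invHull A)) (𝓝 (bubbleMass d c₂ c₃ : ℂ)) := by
  obtain ⟨-, hN, hD⟩ := hJ.tendsto_jetNum_jetDen
  have hd0 : (d : ℂ) ≠ 0 := by exact_mod_cast hd.ne'
  have hlim := (hN.div hD (mul_ne_zero hd0 hd0)).neg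
  have hval : -(((d : ℂ) * c₃ - (c₂ : ℂ) ^ 2) / ((d : ℂ) * d)) = (bubbleMass d c₂ c₃ : ℂ) := by
    rw [bubbleMass]
    push_cast
    field_simp
    ring
  rw [hval] at hlim
  refine hlim.congr' ?_
  filter_upwards [mem_inf_of_right (mem_principal_self _)] with w hw
  have hz0 : -w⁻¹ ≠ 0 := diff_subset_ne_zero A (neg_inv_mem_diff hw)
  have hw0 : w ≠ 0 := fun h ↦ by rw [h, inv_zero, neg_zero] at hz0; exact hz0 rfl
  have hwz : w * -w⁻¹ = -1 := by rw [mul_neg, mul_inv_cancel₀ hw0]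
  simp only [Pi.div_apply]
  rw [invertedMap_sub_self_eq hd hw, ← mul_assoc, hwz, neg_one_mul]

variable {δ : ℝ} (hδ : 0 < δ) (hAδ : Disjoint (ball (0 : ℂ) δ) A)
include hδ hAδ

/-- **[LSW] (5.1): `−SΦ(0)/6 = a(invHull A)`** — the bubble mass of the jet of `Φ` at `0` is
the half-plane capacity of the inverted hull (with its hydrodynamic map `ψ`).
[cite: LawlerSchrammWerner2003Restriction, §5 eq. (5.1)] -/
theorem HasRestrictionJet.hcap_invertedMap :
    hcap (invHull A) (invertedMap Φ d hd (c₂ / d)) = bubbleMass d c₂ c₃ := by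
  have hb := isBounded_invHull_inter hδ hAδ
  haveI := IsHydrodynamicMap.neBot_cocompact_inf hb
  have h1 := (hJ.isHydrodynamicMap_invertedMap hd).tendsto_mul_sub_self hb
  have h2 := hJ.tendsto_mul_invertedMap_sub_self hd
  exact_mod_cast tendsto_nhds_unique h1 h2

/-- **`−SΦ(0)/6 ≥ 0`** ([LSW] §5: "Consequently, `Sg_A ≤ 0` on `ℝ ∖ A`"; here at the point `0`,
for a hull off a ball about `0`): `0 ≤ bubbleMass d c₂ c₃` for every jet of a conformal map
`Φ : ℍ ∖ A → ℍ` with `d > 0`, because it is a half-plane capacity (`hcap ≥ 0`).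
[cite: LawlerSchrammWerner2003Restriction, §5 (after (5.1))] -/
theorem HasRestrictionJet.bubbleMass_nonneg : 0 ≤ bubbleMass d c₂ c₃ := by
  rw [← hJ.hcap_invertedMap hd hδ hAδ]
  exact (hJ.isHydrodynamicMap_invertedMap hd).hcap_nonneg (isBounded_invHull_inter hδ hAδ)

/-- **`−SΦ(0)/6 > 0` as soon as `A` meets `ℍ`** (`hcap > 0` for hulls meeting `ℍ`, Lawler (3.8)).
[cite: Lawler2005, §3.4 (3.8)] -/
theorem HasRestrictionJet.bubbleMass_pos (hne : (A ∩ upperHalfPlaneSet).Nonempty) :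
    0 < bubbleMass d c₂ c₃ := by
  rw [← hJ.hcap_invertedMap hd hδ hAδ]
  exact (hJ.isHydrodynamicMap_invertedMap hd).hcap_pos (isBounded_invHull_inter hδ hAδ)
    (invHull_inter_nonempty hne)

end Expansion

end Literature.Probability.RandomPlanarGeometry

end
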